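import Literature.IUT.HodgeArakelov.EtaleThetaDataOfSetting
import Literature.AnabelianGeometry.EtaleTheta.ContH1CoeffChange

/-!
# Bridge lemma: the `l·Δ_Θ`-class of the chosen `l`-th root maps to `η̈^Θ|_{Π^tp_Ÿ̲̲}` under change of coefficients

Mochizuki, *The étale theta function …*, Def. 2.7 p. 41 ("the class `η̈^Θ` determines a class
`η̲̈^Θ ∈ H¹(Π^tp_Ÿ̲̲, l·Δ_Θ)`") [cite: MochizukiEtTh2009, Def 2.7 p.41]; [IUTchII] Prop. 1.4 p. 27 (the orbit
`η̈^{Θ,l·ℤ×μ₂}` of an `l`-th root) [cite: Mochizuki2012, Prop 1.4 p.27]. PROOF-ONLY companion (abc-iut cell; requested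
by abc-iut-L6-t1 2026-08-25T23:40:04Z for the closing halves of IUTchII:Prop1.4 / Prop2.2 (ii) / Cor1.12 held
by w4-d025 / w4-d010 / w4-d043) of `EtaleThetaDataOfSetting.lean` (abc-iut-L6-t1, p411758) and
`ContH1CoeffChange.lean` (this seat): for ANY `l·Δ_Θ`-valued lift `f` read as an `l·Δ_Θ`-coefficient cocycle on
`Π_Ÿ(Π) ∩ J ⊆ Π^tp_X̲̲` (`liftCocycle`), the change of coefficients `H¹(·, l·Δ_Θ) → H¹(·, Δ_Θ)` along `l·Δ_Θ ≤ Δ_Θ`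
(`ContH1.coeffChange`) sends its class to the class of `f` itself read with `Δ_Θ`-coefficients
(`coeffChange_rootClass`, `coeffChange_liftClass`); in particular for the CHOSEN root (`rootLiftClass`,
`coeffChange_rootLiftClass`), which thereby IS the pull-back of `η̈^Θ|_{Π^tp_Ÿ̲̲}` (`E.etaDd`) to `Π_Ÿ(Π) ⊆ Π^tp_X̲̲`
(`coeffChange_rootLiftClass_eq_comap_etaDd`, via t1's `rootLift_mk` and `ContH1.comap`); and the torsion transfer
`pow_l_eq_one_of_coeffChange_eq_one` / `div_pow_l_eq_one_of_coeffChange_eq` (kernel of the coefficient change is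
`l`-torsion). Nothing is asserted about [IUTchIII]; no definition (proof-only).
-/

namespace Literature.IUT.HodgeArakelov

open Literature.AnabelianGeometry.EtaleTheta (ContH1 contCocycles)

noncomputable section

namespace EtaleThetaDataOfSetting

variable {p : ℕ} [Fact p.Prime] {D : Literature.AnabelianGeometry.EtaleTheta.ThetaSetting p}
  {E : D.EtaleThetaData} {l : ℕ} (C : E.DoubleUnderline l)

/-- A `Δ_Θ`-valued continuous cocycle `f` on `Π^tp_Ÿ̲̲`, read as the `Δ_Θ`-COEFFICIENT function
`x ↦ f(x)` on `Π_Ÿ(Π) ∩ J ⊆ Π^tp_X̲̲` (the `Δ_Θ`-coefficient twin of t1's `liftCocycle`), is a continuous cocycle.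
[cite: MochizukiEtTh2009, Def 2.7 p.41] -/
theorem liftCocycleΔ_mem (J : Subgroup (Pi C)) (f : ↥C.GtpYdduu → ↥D.DeltaTheta)
    (hf : f ∈ contCocycles D.toTheta D.DeltaTheta C.GtpYdduu) :
    (fun x => f (toYdduu C J x)) ∈ contCocycles (phi C) D.DeltaTheta (PiYdd C ⊓ J) :=
  ⟨hf.1.comp (continuous_toYdduu C J), fun g h => hf.2 (toYdduu C J g) (toYdduu C J h)⟩

/-- Every element of `Δ_Θ` has its `l`-th power in `l·Δ_Θ` (definition of `l·Δ_Θ`).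
[cite: MochizukiEtTh2009, Prop 2.12 (i) p.45] -/
theorem pow_mem_lDeltaTheta (a : ↥D.DeltaTheta) : ((a : D.GtpTheta) ^ l) ∈ D.lDeltaTheta l :=
  ⟨a, a.2, rfl⟩

/-- **Torsion bound on the kernel of `H¹(Π_Ÿ(Π) ∩ J, l·Δ_Θ) → H¹(Π_Ÿ(Π) ∩ J, Δ_Θ)`**: a class killed by the change of
coefficients is `l`-torsion (`ContH1.pow_eq_one_of_coeffChange_eq_one` with `A = l·Δ_Θ ≤ Δ_Θ = A'`, `n = l`) — so
«equal up to torsion in `H¹(−, Δ_Θ)`» statements about `l·Δ_Θ`-classes ([IUTchII] Prop. 1.4 `θ(Π)`, `∞θ(Π)`: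
"`μ_l`-multiples", "up to torsion") can be read off the `Δ_Θ`-classes of [EtTh] §1. [cite: Mochizuki2012, Prop 1.4 p.27] -/
theorem pow_l_eq_one_of_coeffChange_eq_one (J : Subgroup (Pi C))
    (x : ContH1 (phi C) (D.lDeltaTheta l) (PiYdd C ⊓ J))
    (hx : ContH1.coeffChange (phi C) (D.lDeltaTheta_le l) (PiYdd C ⊓ J) x = 1) : x ^ l = 1 :=
  ContH1.pow_eq_one_of_coeffChange_eq_one (phi C) (D.lDeltaTheta_le l) (PiYdd C ⊓ J) l
    (pow_mem_lDeltaTheta (D := D) (l := l)) x hx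

/-- Hence two `l·Δ_Θ`-classes with the same `Δ_Θ`-image differ by an `l`-torsion class.
[cite: Mochizuki2012, Prop 1.4 p.27] -/
theorem div_pow_l_eq_one_of_coeffChange_eq (J : Subgroup (Pi C))
    (x y : ContH1 (phi C) (D.lDeltaTheta l) (PiYdd C ⊓ J))
    (hxy : ContH1.coeffChange (phi C) (D.lDeltaTheta_le l) (PiYdd C ⊓ J) x =
      ContH1.coeffChange (phi C) (D.lDeltaTheta_le l) (PiYdd C ⊓ J) y) : (x / y) ^ l = 1 :=
  pow_l_eq_one_of_coeffChange_eq_one C J (x / y) (by rw [map_div, hxy, div_self'])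

/-- **Torsion is reflected** by `H¹(Π_Ÿ(Π) ∩ J, l·Δ_Θ) → H¹(Π_Ÿ(Π) ∩ J, Δ_Θ)` (for `l > 0`): two `l·Δ_Θ`-classes
differ by a torsion class iff their `Δ_Θ`-images do — the form in which «coincides, up to torsion» ([IUTchII] Prop. 1.4
`∞θ(Π)`; Cor. 1.12 (ii)) transfers between the two coefficient systems. [cite: Mochizuki2012, Prop 1.4 p.27] -/
theorem isOfFinOrder_div_iff_of_coeffChange (hl : 0 < l) (J : Subgroup (Pi C))
    (x y : ContH1 (phi C) (D.lDeltaTheta l) (PiYdd C ⊓ J)) :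
    IsOfFinOrder (ContH1.coeffChange (phi C) (D.lDeltaTheta_le l) (PiYdd C ⊓ J) x /
        ContH1.coeffChange (phi C) (D.lDeltaTheta_le l) (PiYdd C ⊓ J) y) ↔ IsOfFinOrder (x / y) :=
  ContH1.isOfFinOrder_div_iff_of_coeffChange (phi C) (D.lDeltaTheta_le l) (PiYdd C ⊓ J) hl
    (pow_mem_lDeltaTheta (D := D) (l := l)) x y

/-- **Change of coefficients on a lifted class**: under `H¹(Π_Ÿ(Π) ∩ J, l·Δ_Θ) → H¹(Π_Ÿ(Π) ∩ J, Δ_Θ)` the class of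
the `l·Δ_Θ`-coefficient reading `liftCocycle C J f hval` of an `l·Δ_Θ`-valued lift `f` is the class of `f` read
with `Δ_Θ`-coefficients. [cite: MochizukiEtTh2009, Def 2.7 p.41] -/
theorem coeffChange_liftClass (J : Subgroup (Pi C)) (f : ↥C.GtpYdduu → ↥D.DeltaTheta)
    (hf : f ∈ contCocycles D.toTheta D.DeltaTheta C.GtpYdduu)
    (hval : ∀ g, (f g : D.GtpTheta) ∈ D.lDeltaTheta l) :
    ContH1.coeffChange (phi C) (D.lDeltaTheta_le l) (PiYdd C ⊓ J)
        (ContH1.mk (liftCocycle C J f hval) (liftCocycle_mem C J f hf hval)) =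
      ContH1.mk (fun x => f (toYdduu C J x)) (liftCocycleΔ_mem C J f hf) := by
  rw [ContH1.coeffChange_mk]
  congr 1

/-- In particular for `J = ⊤` and a root cocycle (t1's `rootClass`). [cite: MochizukiEtTh2009, Def 2.7 p.41] -/
theorem coeffChange_rootClass (f : contCocycles D.toTheta D.DeltaTheta C.GtpYdduu)
    (hval : ∀ g, (f.1 g : D.GtpTheta) ∈ D.lDeltaTheta l) :
    ContH1.coeffChange (phi C) (D.lDeltaTheta_le l) (PiYdd C ⊓ ⊤) (rootClass C f hval) =
      ContH1.mk (fun x => f.1 (toYdduu C ⊤ x)) (liftCocycleΔ_mem C ⊤ f.1 f.2) :=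
  coeffChange_liftClass C ⊤ f.1 f.2 hval

/-- **The chosen `l`-th root**: under `H¹(Π^tp_Ÿ̲̲ ∩ ⊤, l·Δ_Θ) → H¹(Π^tp_Ÿ̲̲ ∩ ⊤, Δ_Θ)` the class `η̲̈^Θ` of the chosen
root (`rootLiftClass`) is the class of `rootLift` read with `Δ_Θ`-coefficients — whose `Δ_Θ`-class on `Π^tp_Ÿ̲̲`
is `η̈^Θ|_{Π^tp_Ÿ̲̲}` by t1's `rootLift_mk`. [cite: Mochizuki2012, Prop 1.4 p.27] -/
theorem coeffChange_rootLiftClass :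
    ContH1.coeffChange (phi C) (D.lDeltaTheta_le l) (PiYdd C ⊓ ⊤) (rootLiftClass C) =
      ContH1.mk (fun x => (rootLift C).1 (toYdduu C ⊤ x)) (liftCocycleΔ_mem C ⊤ (rootLift C).1 (rootLift C).2) :=
  coeffChange_rootClass C (rootLift C) (rootLift_val C)

/-- `Π_Ÿ(Π) ∩ J ⊆ Π^tp_X̲̲` maps into `Π^tp_Ÿ̲̲ ⊆ Π^tp_X` under the inclusion `Π^tp_X̲̲ ↪ Π^tp_X`.
[cite: Mochizuki2012, Prop 1.4 p.27] -/
theorem map_subtype_piYdd_inf_le (J : Subgroup (Pi C)) : (PiYdd C ⊓ J).map C.Huu.subtype ≤ C.GtpYdduu := by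
  rintro _ ⟨x, hx, rfl⟩
  exact Subgroup.mem_subgroupOf.mp (Subgroup.mem_inf.mp hx).1

/-- **The sentence the closing halves consume** ([EtTh] Def. 2.7 p. 41 «the class `η̈^Θ` determines a class
`η̲̈^Θ ∈ H¹(Π^tp_Ÿ̲̲, l·Δ_Θ)`», read backwards): under the change of coefficients `H¹(Π_Ÿ(Π), l·Δ_Θ) → H¹(Π_Ÿ(Π), Δ_Θ)`
the `l·Δ_Θ`-class `η̲̈^Θ` of the chosen root (t1's `rootLiftClass`) IS the pull-back to `Π_Ÿ(Π) = Π^tp_Ÿ̲̲ ⊆ Π^tp_X̲̲`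
(`ContH1.comap` along `Π^tp_X̲̲ ↪ Π^tp_X`) of the restriction `η̈^Θ|_{Π^tp_Ÿ̲̲}` of abc-iut-L2-t1's étale theta class
`E.etaDd` (via t1's `rootLift_mk`). [cite: MochizukiEtTh2009, Def 2.7 p.41] -/
theorem coeffChange_rootLiftClass_eq_comap_etaDd :
    ContH1.coeffChange (phi C) (D.lDeltaTheta_le l) (PiYdd C ⊓ ⊤) (rootLiftClass C) =
      ContH1.comap D.toTheta D.DeltaTheta C.Huu.subtype continuous_subtype_val
        (map_subtype_piYdd_inf_le C ⊤) (ContH1.res D.toTheta D.DeltaTheta inf_le_left E.etaDd) := by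
  rw [coeffChange_rootLiftClass, ← rootLift_mk, ContH1.comap_mk]
  rfl

end EtaleThetaDataOfSetting

end

end Literature.IUT.HodgeArakelov
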